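import Mathlib
import Summits.SmoothPoincare4.SmoothPoincare4.Theorems.SullivanDualTameOrBrodyR4OfNoCusp
import Literature.Geometry.Symplectic.JHolomorphicCuspGlue

/-!
# Crux `TameOrBrodyR4` (stmt-SmoothPoincare4-7826) modulo Wendl's representation formula (line `Sketch`, lead c7)

`helper_tameOrBrodyR4_of_representationFormula`: the route declaration
`Theses.SullivanDual.TameOrBrodyR4` follows from the local representation formula with branch
comparison for `J`-holomorphic curves in dimension four [Wendl 2020, App. B, Thm B.23 and (B.12)],
in EXACTLY the form `hX` consumed by
`Literature.Geometry.Symplectic.CuspDoublePoints.jHolomorphic_immersed_of_limitEmbedded_punctured_of_representationFormula`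
(`Literature/Geometry/Symplectic/JHolomorphicCuspGlue.lean`) and by
`Literature.Geometry.Symplectic.jHolomorphic_localBranchDichotomy_of_representationFormula`.

This records in the kernel that the trust base of the line is `{hX}`: the crux was reduced to
McDuff's no-cusp fact `Literature.Geometry.Symplectic.jHolomorphic_immersed_of_limitEmbedded_punctured`
(`helper_tameOrBrodyR4OfNoCusp`, `…OfNoCusp.lean`: CORE-A `stub_localFamilyUnique` proved, CORE-B
`helper_immersedLimitsOfNoCusp` proved modulo the fact, composition `TameOrBrodyR4_of_deep2`), and
Literature reduced that fact to `hX` (McDuff 1991 Thm 1.1/1.5 on the immersed locus via the chart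
theorem `not_injOn_of_chartCusp` and the Weierstrass theorem `JHolomorphicWeierstrassR4_holds`).
When `hX` is proved (its bricks — the `k`-th-root and adapted normal forms, the normal push-off
frame and its Cauchy–Riemann inequality, the rotated branch with `C¹` regularity and bounded
derivative, the punctured similarity factorisation — are in the tree), the crux closes by one
application of this theorem.
-/

-- the registered namespace `Summit.SmoothPoincare4.SmoothPoincare4.…` repeats a component
set_option linter.dupNamespace false

noncomputable section

open scoped Topology ContDiff
open Set Filter Metric Asymptotics

namespace Summit.SmoothPoincare4.SmoothPoincare4.Cruxes.TameOrBrodyR4.Sketch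

/-- **Registered helper `helper_tameOrBrodyR4_of_representationFormula`: the crux modulo Wendl's
representation formula with branch comparison (Wendl 2020, Thm B.23, (B.12)).** The hypothesis is
verbatim the `hX` of
`Literature.Geometry.Symplectic.CuspDoublePoints.jHolomorphic_immersed_of_limitEmbedded_punctured_of_representationFormula`:
for every smooth almost complex structure `J` on an open set `U` of a real `4`-space `F` and every
smooth `J`-holomorphic `u : ball z₀ R → U` not locally constant at `z₀` there are `k ≥ 1`, a smooth
chart `Θ` about `u z₀`, a `C¹` chart `ξ` about `z₀` (smooth off `z₀`) and a `C¹` map `û` with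
`û = O(|w|^{k+1})` and `Θ (u z) = ((ξ z)ᵏ, û (ξ z))` near `z₀`, such that for every `ℓ` either
`û (e^{2πiℓ/k} w) = û w` near `0` or `û (e^{2πiℓ/k} w) - û w = C wᵐ + o(|w|ᵐ)` with `m > k`,
`C ≠ 0`. -/
theorem helper_tameOrBrodyR4_of_representationFormula :
    (∀ (F : Type) [NormedAddCommGroup F] [NormedSpace ℝ F] [FiniteDimensional ℝ F],
      Module.finrank ℝ F = 4 →
      ∀ (J : F → F →L[ℝ] F) (U : Set F), IsOpen U → ContDiffOn ℝ ∞ J U →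
        (∀ x ∈ U, ∀ v : F, J x (J x v) = -v) →
      ∀ (u : ℂ → F) (z₀ : ℂ) (R : ℝ), 0 < R → ContDiffOn ℝ ∞ u (ball z₀ R) →
        MapsTo u (ball z₀ R) U →
        (∀ z ∈ ball z₀ R, ∀ α : ℂ, fderiv ℝ u z (Complex.I * α) = J (u z) (fderiv ℝ u z α)) →
        (∃ᶠ z in 𝓝 z₀, u z ≠ u z₀) →
        ∃ (k : ℕ) (Θ : OpenPartialHomeomorph F (ℂ × ℂ)) (ξ : OpenPartialHomeomorph ℂ ℂ)
          (uhat : ℂ → ℂ) (ρ ρ₁ : ℝ),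
          0 < k ∧ 0 < ρ ∧ 0 < ρ₁ ∧
          u z₀ ∈ Θ.source ∧ Θ (u z₀) = 0 ∧ ContDiffOn ℝ ∞ Θ Θ.source ∧
            ContDiffOn ℝ ∞ Θ.symm Θ.target ∧
          ball z₀ ρ ⊆ ξ.source ∧ ξ z₀ = 0 ∧ ContDiffOn ℝ 1 ξ ξ.source ∧
            ContDiffOn ℝ 1 ξ.symm ξ.target ∧ ContDiffOn ℝ ∞ ξ (ξ.source \ {z₀}) ∧
          MapsTo ξ (ball z₀ ρ) (ball 0 ρ₁) ∧ ContDiffOn ℝ 1 uhat (ball 0 ρ₁) ∧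
            (uhat =O[𝓝 0] fun w : ℂ => ‖w‖ ^ (k + 1)) ∧
            (∀ z ∈ ball z₀ ρ, u z ∈ Θ.source ∧ Θ (u z) = ((ξ z) ^ k, uhat (ξ z))) ∧
          ∀ ℓ : ℕ,
            (∀ᶠ w in 𝓝 (0 : ℂ),
              uhat (Complex.exp (2 * Real.pi * Complex.I * (ℓ / k : ℂ)) * w) = uhat w) ∨
            ∃ (m : ℕ) (C : ℂ), k < m ∧ C ≠ 0 ∧
              (fun w : ℂ =>
                  uhat (Complex.exp (2 * Real.pi * Complex.I * (ℓ / k : ℂ)) * w) - uhat w -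
                    C * w ^ m)
                =o[𝓝 (0 : ℂ)] fun w : ℂ => ‖w‖ ^ m) →
    Summit.SmoothPoincare4.SmoothPoincare4.Theses.SullivanDual.TameOrBrodyR4 :=
  fun hX => helper_tameOrBrodyR4OfNoCusp
    (Literature.Geometry.Symplectic.CuspDoublePoints.jHolomorphic_immersed_of_limitEmbedded_punctured_of_representationFormula
      hX)

end Summit.SmoothPoincare4.SmoothPoincare4.Cruxes.TameOrBrodyR4.Sketch
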